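import Mathlib
import HarnessLib
import Summits.HubbardSuperconductivity.HubbardSuperconductivity.Theorems.KLProgrammeH10TwoPointLimitPerturbedCountBridge
import Summits.HubbardSuperconductivity.HubbardSuperconductivity.Theorems.KLProgrammeCountPairsOffsetNondegP

/-!
# Route `KLProgramme` — crux K1 `H10TwoPointLimit` (stmt-HubbardSuperconductivity-19938):
# the EXPLICIT perturbation size `κ*` of the sector count on the moving curve

`exists_small_constants_perturbed` (`…PerturbedCountPairs.lean`) obtains the admissible perturbation size `κ` by continuity, i.e. not in closed form.
Here the five smallness conditions of `count_pairs_perturbed_exists` are derived for EVERY `0 ≤ κ ≤ pcKappa B τ` — the closed-form size of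
`KLProgrammePerturbedCountConstantsDefs.lean` — from the lineage's four FREE conditions taken with the acceleration constant `A' = pcAprime B`
(`perturbed_conditions_of_free`), via uniform majorants of the moving-curve constants on `0 ≤ κ ≤ min(1, Dt_min/2)` (`pcCV_le_bar`, `pcSE_le_bar`,
`pcU1_le_bar`, `pcU2_le_bar`, `pcAE_le_bar`) and affine-in-`κ` majorants of the losses (`pcE4_le_affine`, `pcOdd_le_affine`, `pcEven_le_affine`,
`pcDiag_le_affine`). With the lineage's `exists_small_constants_offset` for the bundle `A₂ ↦ A'` this gives `exists_small_constants_perturbed_explicit`: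
free constants `(τ, λ, η₀, η₁)` and the EXPLICIT `κ* = pcKappa B τ` (risk r1 «explicit constants»: with fs-1's sharp `BandBounds` numbers on K1's
window every quantity is a closed-form expression in the window). Everything is PROVED; no definitions.
References: BGM 2006 Lemma 3.1 / App. A2–A3 [cite: BenfattoGiulianiMastropietro2006]; HOME/prover-p4/PORT-NOTE.md §7 (iii).
-/

noncomputable section

namespace Summit.HubbardSuperconductivity.HubbardSuperconductivity.Theorems.PerturbedFermiCurve

set_option linter.dupNamespace false -- summit = problem name (single-conjunct summit), D-0017

open Real Set
open Literature.MathematicalPhysics.QuantumLattice Literature.MathematicalPhysics.QuantumLattice.BandSectorCounting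
open Summit.HubbardSuperconductivity.HubbardSuperconductivity.Theorems.CountPairsOffset

section Majorants

variable {a b : ℝ} (B : BandBounds a b) {κ : ℝ} (hκ0 : 0 ≤ κ) (hκ1 : κ ≤ 1) (hκD : κ ≤ B.Dtmin / 2)
include hκ0 hκ1 hκD

omit hκ1 in
/-- `C_V(κ) ≤ κ·C̄_V`. [folklore] -/
theorem pcCV_le_bar : pcCV B κ ≤ κ * pcCVbar B := by
  have hDt := B.Dtmin_pos; have hs := B.smax_pos
  unfold pcCV pcCVbar
  have hden : B.Dtmin / 2 ≤ B.Dtmin - κ := by linarith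
  calc κ * (π * Real.sqrt 2 + 2 * B.smax) / (B.Dtmin - κ) ≤ κ * (π * Real.sqrt 2 + 2 * B.smax) / (B.Dtmin / 2) :=
        div_le_div_of_nonneg_left (by positivity) (by positivity) hden
    _ = κ * (2 * (π * Real.sqrt 2 + 2 * B.smax) / B.Dtmin) := by field_simp

omit hκ0 hκ1 hκD in
/-- `0 ≤ C̄_V`, `0 < S̄_E`, `0 ≤ Ū₁`, `0 ≤ Ū₂`, `0 < Ā_E`, `0 < pcE4slope`, `0 < pcOddSlope`, `0 < pcEvenSlope`, `0 < pcDiagSlope`. [folklore] -/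
theorem pcbar_pos : 0 ≤ pcCVbar B ∧ 0 < pcSEbar B ∧ 0 ≤ pcU1bar B ∧ 0 ≤ pcU2bar B ∧ 0 < pcAEbar B ∧ 0 < pcE4slope B ∧
    0 < pcOddSlope B ∧ 0 < pcEvenSlope B ∧ 0 < pcDiagSlope B := by
  have hDt := B.Dtmin_pos; have hs := B.smax_pos; have hCg := B.Cg_pos
  have h1 : 0 ≤ pcCVbar B := by unfold pcCVbar; positivity
  have h2 : 0 < pcSEbar B := by unfold pcSEbar; linarith
  have h3 : 0 ≤ pcU1bar B := by unfold pcU1bar; positivity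
  have h4 : 0 ≤ pcU2bar B := by unfold pcU2bar; positivity
  have h5 : 0 < pcAEbar B := by unfold pcAEbar; positivity
  have h6 : 0 < pcE4slope B := by unfold pcE4slope; positivity
  have h7 : 0 < pcOddSlope B := by unfold pcOddSlope; positivity
  have h8 : 0 < pcEvenSlope B := by unfold pcEvenSlope; positivity
  have h9 : 0 < pcDiagSlope B := by unfold pcDiagSlope; positivity
  exact ⟨h1, h2, h3, h4, h5, h6, h7, h8, h9⟩

/-- `0 ≤ S_E(κ) ≤ S̄_E`. [folklore] -/
theorem pcSE_le_bar : 0 ≤ pcSE B κ ∧ pcSE B κ ≤ pcSEbar B := by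
  have hDt := B.Dtmin_pos
  obtain ⟨hCV0, hSE0, -⟩ := pc_pos B hκ0 (by linarith) hκ0
  obtain ⟨hCVb, -⟩ := pcbar_pos B
  have h := pcCV_le_bar B hκ0 hκD
  refine ⟨hSE0.le, ?_⟩
  unfold pcSE pcSEbar
  nlinarith

omit hκ0 in
/-- `U₁(κ) ≤ Ū₁`. [folklore] -/
theorem pcU1_le_bar : pcU1 B κ ≤ pcU1bar B := by
  have hDt := B.Dtmin_pos
  unfold pcU1 pcU1bar
  have hden : B.Dtmin / 2 ≤ B.Dtmin - κ := by linarith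
  calc (4 + κ) * (π * Real.sqrt 2) / (B.Dtmin - κ) ≤ 5 * (π * Real.sqrt 2) / (B.Dtmin / 2) :=
        div_le_div₀ (by positivity) (by nlinarith [Real.pi_pos, Real.sqrt_nonneg 2, mul_pos Real.pi_pos (Real.sqrt_pos.2 two_pos)])
          (by positivity) hden
    _ = 10 * (π * Real.sqrt 2) / B.Dtmin := by field_simp; norm_num

/-- `U₂(κ,κ) ≤ Ū₂`. [folklore] -/
theorem pcU2_le_bar : pcU2 B κ κ ≤ pcU2bar B := by
  have hDt := B.Dtmin_pos
  obtain ⟨hSE0, hSEb⟩ := pcSE_le_bar B hκ0 hκ1 hκD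
  have hU1 := pcU1_le_bar B hκ1 hκD
  obtain ⟨-, -, hU10, -⟩ := pc_pos B hκ0 (by linarith) hκ0
  obtain ⟨-, hSEbar0, hU1bar0, -⟩ := pcbar_pos B
  have hps : 0 < π * Real.sqrt 2 := by positivity
  have hsq : pcSE B κ ^ 2 ≤ pcSEbar B ^ 2 := pow_le_pow_left₀ hSE0 hSEb 2
  have hnum : (4 + κ) * pcSE B κ ^ 2 + (8 + 2 * κ) * pcU1 B κ + (4 + κ) * (π * Real.sqrt 2) ≤
      5 * pcSEbar B ^ 2 + 10 * pcU1bar B + 5 * (π * Real.sqrt 2) := by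
    have t1 : (4 + κ) * pcSE B κ ^ 2 ≤ 5 * pcSEbar B ^ 2 := by nlinarith [sq_nonneg (pcSE B κ)]
    have t2 : (8 + 2 * κ) * pcU1 B κ ≤ 10 * pcU1bar B := by nlinarith
    nlinarith
  have hden : B.Dtmin / 2 ≤ B.Dtmin - κ := by linarith
  unfold pcU2
  calc _ ≤ (5 * pcSEbar B ^ 2 + 10 * pcU1bar B + 5 * (π * Real.sqrt 2)) / (B.Dtmin / 2) :=
        div_le_div₀ (by positivity) hnum (by positivity) hden
    _ = _ := by unfold pcU2bar; field_simp

/-- `0 ≤ A_E(κ,κ) ≤ Ā_E`. [folklore] -/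
theorem pcAE_le_bar : 0 ≤ pcAE B κ κ ∧ pcAE B κ κ ≤ pcAEbar B := by
  have hDt := B.Dtmin_pos
  obtain ⟨-, -, -, -, hAE0, -⟩ := pc_pos B hκ0 (by linarith) hκ0
  have hU2 := pcU2_le_bar B hκ0 hκ1 hκD
  have hU1 := pcU1_le_bar B hκ1 hκD
  refine ⟨hAE0.le, ?_⟩
  unfold pcAE pcAEbar
  linarith

/-- **Affine majorant of the covering tolerance**: `ε₄(κ,κ;L,η₀) ≤ L/2 + 2s_max η₀/Dt_min + κ·pcE4slope` (`η₀` arbitrary). [folklore] -/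
theorem pcE4_le_affine (L η₀ : ℝ) : pcE4 B κ κ L η₀ ≤ L / 2 + 2 * B.smax * (η₀ / B.Dtmin) + κ * pcE4slope B := by
  have hDt := B.Dtmin_pos; have hs := B.smax_pos
  obtain ⟨hSE0, hSEb⟩ := pcSE_le_bar B hκ0 hκ1 hκD
  have hCV := pcCV_le_bar B hκ0 hκD
  have t1 : κ * pcSE B κ / 2 ≤ κ * pcSEbar B / 2 := by
    have := mul_le_mul_of_nonneg_left hSEb hκ0; linarith
  unfold pcE4 pcE4slope
  have e : 2 * B.smax * (2 * κ / B.Dtmin) = κ * (4 * B.smax / B.Dtmin) := by ring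
  rw [e]
  nlinarith

/-- The common first two terms of `pcOdd`/`pcEven`: `4C_V(S_E + s_max) + (κS_E² + κA_E)/2 ≤ κ(4C̄_V(S̄_E + s_max) + (S̄_E² + Ā_E)/2)`. [folklore] -/
theorem pc_head_le : 4 * pcCV B κ * (pcSE B κ + B.smax) + (κ * pcSE B κ ^ 2 + κ * pcAE B κ κ) / 2 ≤
    κ * (4 * pcCVbar B * (pcSEbar B + B.smax) + (pcSEbar B ^ 2 + pcAEbar B) / 2) := by
  have hs := B.smax_pos; have hDt := B.Dtmin_pos
  obtain ⟨hSE0, hSEb⟩ := pcSE_le_bar B hκ0 hκ1 hκD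
  obtain ⟨hAE0, hAEb⟩ := pcAE_le_bar B hκ0 hκ1 hκD
  obtain ⟨hCV0, -⟩ := pc_pos B hκ0 (by linarith) hκ0
  obtain ⟨hCVb0, -⟩ := pcbar_pos B
  have hCV := pcCV_le_bar B hκ0 hκD
  have t1 : 4 * pcCV B κ * (pcSE B κ + B.smax) ≤ 4 * (κ * pcCVbar B) * (pcSEbar B + B.smax) :=
    mul_le_mul (mul_le_mul_of_nonneg_left hCV (by norm_num)) (by linarith) (by linarith) (by positivity)
  have t2 : κ * pcSE B κ ^ 2 ≤ κ * pcSEbar B ^ 2 := mul_le_mul_of_nonneg_left (pow_le_pow_left₀ hSE0 hSEb 2) hκ0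
  have t3 : κ * pcAE B κ κ ≤ κ * pcAEbar B := mul_le_mul_of_nonneg_left hAEb hκ0
  nlinarith

/-- **Affine majorant of the Cooper-range loss**: for `L, η₀, τ ≥ 0`,
`pcOdd(κ,κ,κ;L,η₀,τ) ≤ 2Ā_E(η₀/Dt_min + s_max(C_g(L/2 + 2s_max η₀/Dt_min) + τ)) + κ·pcOddSlope`. [folklore] -/
theorem pcOdd_le_affine {L η₀ τ : ℝ} (hL : 0 ≤ L) (hη₀ : 0 ≤ η₀) (hτ : 0 ≤ τ) :
    pcOdd B κ κ κ L η₀ τ ≤ 2 * pcAEbar B * (η₀ / B.Dtmin + B.smax * (B.Cg * (L / 2 + 2 * B.smax * (η₀ / B.Dtmin)) + τ)) +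
      κ * pcOddSlope B := by
  have hs := B.smax_pos; have hDt := B.Dtmin_pos; have hCg := B.Cg_pos
  obtain ⟨hAE0, hAEb⟩ := pcAE_le_bar B hκ0 hκ1 hκD
  obtain ⟨-, -, -, -, hAEbar0, he4s, -⟩ := pcbar_pos B
  have hhead := pc_head_le B hκ0 hκ1 hκD
  have hE4 := pcE4_le_affine B hκ0 hκ1 hκD L η₀
  -- the bracket of the third term and its majorant
  set X := η₀ / B.Dtmin + 2 * κ / B.Dtmin + B.smax * (B.Cg * pcE4 B κ κ L η₀ + τ) with hX
  set Xbar := η₀ / B.Dtmin + B.smax * (B.Cg * (L / 2 + 2 * B.smax * (η₀ / B.Dtmin)) + τ) +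
    κ * (2 / B.Dtmin + B.smax * (B.Cg * pcE4slope B)) with hXbar
  have hE4_0 : 0 ≤ pcE4 B κ κ L η₀ := by
    obtain ⟨hCV0, hSE0, -⟩ := pc_pos B hκ0 (by linarith) hκ0
    unfold pcE4; positivity
  have hX0 : 0 ≤ X := by rw [hX]; positivity
  have hXle : X ≤ Xbar := by
    rw [hX, hXbar]
    have := mul_le_mul_of_nonneg_left (mul_le_mul_of_nonneg_left hE4 hCg.le) hs.le
    have e : 2 * κ / B.Dtmin = κ * (2 / B.Dtmin) := by ring
    rw [e]; nlinarith
  have t3 : 2 * pcAE B κ κ * X ≤ 2 * pcAEbar B * Xbar :=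
    mul_le_mul (by linarith) hXle hX0 (by positivity)
  have hunf : pcOdd B κ κ κ L η₀ τ = 4 * pcCV B κ * (pcSE B κ + B.smax) + (κ * pcSE B κ ^ 2 + κ * pcAE B κ κ) / 2 + 2 * pcAE B κ κ * X := by
    rw [hX]; unfold pcOdd; ring
  rw [hunf]
  have e : 2 * pcAEbar B * Xbar = 2 * pcAEbar B * (η₀ / B.Dtmin + B.smax * (B.Cg * (L / 2 + 2 * B.smax * (η₀ / B.Dtmin)) + τ)) +
      κ * (2 * pcAEbar B * (2 / B.Dtmin + B.smax * (B.Cg * pcE4slope B))) := by rw [hXbar]; ring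
  unfold pcOddSlope
  nlinarith

/-- **Affine majorant of the fold loss**: for `λ, η₀, τ ≥ 0`,
`pcEven(κ,κ,κ;λ,η₀,τ) ≤ 2Ā_E(η₀/Dt_min + s_max(C_g(λ + (5/4)Ā_E τ + 2s_max η₀/Dt_min) + τ/2)) + κ·pcEvenSlope`. [folklore] -/
theorem pcEven_le_affine {lam η₀ τ : ℝ} (hlam : 0 ≤ lam) (hη₀ : 0 ≤ η₀) (hτ : 0 ≤ τ) :
    pcEven B κ κ κ lam η₀ τ ≤ 2 * pcAEbar B * (η₀ / B.Dtmin + B.smax * (B.Cg * (lam + 5 / 4 * pcAEbar B * τ + 2 * B.smax * (η₀ / B.Dtmin)) + τ / 2)) +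
      κ * pcEvenSlope B := by
  have hs := B.smax_pos; have hDt := B.Dtmin_pos; have hCg := B.Cg_pos
  obtain ⟨hAE0, hAEb⟩ := pcAE_le_bar B hκ0 hκ1 hκD
  obtain ⟨-, -, -, -, hAEbar0, he4s, -⟩ := pcbar_pos B
  have hhead := pc_head_le B hκ0 hκ1 hκD
  set L := 2 * lam + (4 + κ) * pcAE B κ κ * τ / 2 with hL
  have hE4 := pcE4_le_affine B hκ0 hκ1 hκD L η₀
  have hLle : L / 2 ≤ lam + 5 / 4 * pcAEbar B * τ := by
    rw [hL]
    have : (4 + κ) * pcAE B κ κ * τ ≤ 5 * pcAEbar B * τ :=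
      mul_le_mul_of_nonneg_right (by nlinarith) hτ
    linarith
  set X := η₀ / B.Dtmin + 2 * κ / B.Dtmin + B.smax * (B.Cg * pcE4 B κ κ L η₀ + τ / 2) with hX
  set Xbar := η₀ / B.Dtmin + B.smax * (B.Cg * (lam + 5 / 4 * pcAEbar B * τ + 2 * B.smax * (η₀ / B.Dtmin)) + τ / 2) +
    κ * (2 / B.Dtmin + B.smax * (B.Cg * pcE4slope B)) with hXbar
  have hL0 : 0 ≤ L := by rw [hL]; positivity
  have hE4_0 : 0 ≤ pcE4 B κ κ L η₀ := by
    obtain ⟨hCV0, hSE0, -⟩ := pc_pos B hκ0 (by linarith) hκ0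
    unfold pcE4; positivity
  have hX0 : 0 ≤ X := by rw [hX]; positivity
  have hXle : X ≤ Xbar := by
    rw [hX, hXbar]
    have h1 : pcE4 B κ κ L η₀ ≤ lam + 5 / 4 * pcAEbar B * τ + 2 * B.smax * (η₀ / B.Dtmin) + κ * pcE4slope B := by linarith
    have := mul_le_mul_of_nonneg_left (mul_le_mul_of_nonneg_left h1 hCg.le) hs.le
    have e : 2 * κ / B.Dtmin = κ * (2 / B.Dtmin) := by ring
    rw [e]; nlinarith
  have t3 : 2 * pcAE B κ κ * X ≤ 2 * pcAEbar B * Xbar :=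
    mul_le_mul (by linarith) hXle hX0 (by positivity)
  have t4 : κ * pcAE B κ κ / 2 ≤ κ * pcAEbar B / 2 := by
    have := mul_le_mul_of_nonneg_left hAEb hκ0; linarith
  have hunf : pcEven B κ κ κ lam η₀ τ =
      4 * pcCV B κ * (pcSE B κ + B.smax) + (κ * pcSE B κ ^ 2 + κ * pcAE B κ κ) / 2 + 2 * pcAE B κ κ * X + κ * pcAE B κ κ / 2 := by
    rw [hX, hL]; unfold pcEven; ring
  rw [hunf]
  have e : 2 * pcAEbar B * Xbar =
      2 * pcAEbar B * (η₀ / B.Dtmin + B.smax * (B.Cg * (lam + 5 / 4 * pcAEbar B * τ + 2 * B.smax * (η₀ / B.Dtmin)) + τ / 2)) +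
      κ * (2 * pcAEbar B * (2 / B.Dtmin + B.smax * (B.Cg * pcE4slope B))) := by rw [hXbar]; ring
  unfold pcEvenSlope pcOddSlope
  nlinarith

/-- **Affine majorant of the diagonal loss**: for `η₀, η₁ ≥ 0`,
`pcDiag(κ,κ,κ;η₀,η₁) ≤ (16S̄_E² + 8Ā_E)(η₀/Dt_min + s_max C_g(η₁/4 + 2s_max η₀/Dt_min)) + κ·pcDiagSlope`. [folklore] -/
theorem pcDiag_le_affine {η₀ η₁ : ℝ} (hη₀ : 0 ≤ η₀) (hη₁ : 0 ≤ η₁) :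
    pcDiag B κ κ κ η₀ η₁ ≤ (16 * pcSEbar B ^ 2 + 8 * pcAEbar B) * (η₀ / B.Dtmin + B.smax * (B.Cg * (η₁ / 4 + 2 * B.smax * (η₀ / B.Dtmin)))) +
      κ * pcDiagSlope B := by
  have hs := B.smax_pos; have hDt := B.Dtmin_pos; have hCg := B.Cg_pos
  obtain ⟨hSE0, hSEb⟩ := pcSE_le_bar B hκ0 hκ1 hκD
  obtain ⟨hAE0, hAEb⟩ := pcAE_le_bar B hκ0 hκ1 hκD
  obtain ⟨hCV0, -⟩ := pc_pos B hκ0 (by linarith) hκ0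
  obtain ⟨hCVb0, hSEbar0, -, -, hAEbar0, he4s, -⟩ := pcbar_pos B
  have hCV := pcCV_le_bar B hκ0 hκD
  have hE4 := pcE4_le_affine B hκ0 hκ1 hκD (η₁ / 2) η₀
  have hsq : pcSE B κ ^ 2 ≤ pcSEbar B ^ 2 := pow_le_pow_left₀ hSE0 hSEb 2
  set X := η₀ / B.Dtmin + 2 * κ / B.Dtmin + B.smax * (B.Cg * pcE4 B κ κ (η₁ / 2) η₀) with hX
  set Xbar := η₀ / B.Dtmin + B.smax * (B.Cg * (η₁ / 4 + 2 * B.smax * (η₀ / B.Dtmin))) +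
    κ * (2 / B.Dtmin + B.smax * (B.Cg * pcE4slope B)) with hXbar
  have hE4_0 : 0 ≤ pcE4 B κ κ (η₁ / 2) η₀ := by
    obtain ⟨-, hSE0', -⟩ := pc_pos B hκ0 (by linarith) hκ0
    unfold pcE4; positivity
  have hX0 : 0 ≤ X := by rw [hX]; positivity
  have hXle : X ≤ Xbar := by
    rw [hX, hXbar]
    have h1 : pcE4 B κ κ (η₁ / 2) η₀ ≤ η₁ / 4 + 2 * B.smax * (η₀ / B.Dtmin) + κ * pcE4slope B := by linarith
    have := mul_le_mul_of_nonneg_left (mul_le_mul_of_nonneg_left h1 hCg.le) hs.le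
    have e : 2 * κ / B.Dtmin = κ * (2 / B.Dtmin) := by ring
    rw [e]; nlinarith
  have hco0 : 0 ≤ 16 * pcSE B κ ^ 2 + 8 * pcAE B κ κ := by positivity
  have hcole : 16 * pcSE B κ ^ 2 + 8 * pcAE B κ κ ≤ 16 * pcSEbar B ^ 2 + 8 * pcAEbar B := by linarith
  have t1 : 16 * pcCV B κ * (pcSE B κ + B.smax) ≤ 16 * (κ * pcCVbar B) * (pcSEbar B + B.smax) :=
    mul_le_mul (mul_le_mul_of_nonneg_left hCV (by norm_num)) (by linarith) (by linarith) (by positivity)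
  have t2 : (16 * pcSE B κ ^ 2 + 8 * pcAE B κ κ) * X ≤ (16 * pcSEbar B ^ 2 + 8 * pcAEbar B) * Xbar :=
    mul_le_mul hcole hXle hX0 (by positivity)
  have t3 : 6 * (κ * pcSE B κ ^ 2) ≤ 6 * (κ * pcSEbar B ^ 2) := by
    have := mul_le_mul_of_nonneg_left hsq hκ0; linarith
  have t4 : 4 * (κ * pcAE B κ κ) ≤ 4 * (κ * pcAEbar B) := by
    have := mul_le_mul_of_nonneg_left hAEb hκ0; linarith
  have hunf : pcDiag B κ κ κ η₀ η₁ = 16 * pcCV B κ * (pcSE B κ + B.smax) + (16 * pcSE B κ ^ 2 + 8 * pcAE B κ κ) * X +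
      6 * (κ * pcSE B κ ^ 2) + 4 * (κ * pcAE B κ κ) := by
    rw [hX]; unfold pcDiag; ring
  rw [hunf]
  have e : (16 * pcSEbar B ^ 2 + 8 * pcAEbar B) * Xbar =
      (16 * pcSEbar B ^ 2 + 8 * pcAEbar B) * (η₀ / B.Dtmin + B.smax * (B.Cg * (η₁ / 4 + 2 * B.smax * (η₀ / B.Dtmin)))) +
      κ * ((16 * pcSEbar B ^ 2 + 8 * pcAEbar B) * (2 / B.Dtmin + B.smax * (B.Cg * pcE4slope B))) := by rw [hXbar]; ring
  unfold pcDiagSlope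
  nlinarith

end Majorants

/-! ## The five conditions for every `κ ≤ κ*(τ)` from the free conditions -/

/-- **The perturbed smallness conditions from the free ones, for EVERY `0 ≤ κ ≤ pcKappa B τ`**: if `(τ, λ, η₀, η₁)` satisfy the four
conditions of the lineage's `exists_small_constants_offset` with the acceleration constant `A' = pcAprime B`, then `(τ, λ/2, η₀/2, η₁/2)` with
`κ₀ = κ₁ = κ₂ = κ` satisfy the five conditions of `count_pairs_perturbed_exists`. [folklore] -/
theorem perturbed_conditions_of_free {a b : ℝ} (B : BandBounds a b) {τ lam η₀ η₁ : ℝ} (hτ : 0 < τ) (hlam : 0 < lam) (hη₀ : 0 < η₀)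
    (hη₁ : 0 < η₁)
    (c1 : 2 * (B.Cg * (lam / 2 + 2 * B.smax * (η₀ / B.Dtmin))) ≤ τ)
    (c2 : 4 * pcAprime B * (η₀ / B.Dtmin + B.smax * (B.Cg * (lam + 2 * B.smax * (η₀ / B.Dtmin)) + τ)) ≤ B.hmin)
    (c3 : 2 * pcAprime B * (η₀ / B.Dtmin + B.smax * (B.Cg * (lam + pcAprime B * τ + 2 * B.smax * (η₀ / B.Dtmin)) + τ / 2)) ≤ B.hmin / 2)
    (c4 : (16 * B.smax ^ 2 + 8 * pcAprime B) * (η₀ / B.Dtmin + B.smax * (B.Cg * (η₁ / 4 + 2 * B.smax * (η₀ / B.Dtmin)))) ≤ 2 * B.hmin)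
    {κ : ℝ} (hκ0 : 0 ≤ κ) (hκ : κ ≤ pcKappa B τ) :
    2 * (B.Cg * pcE4 B κ κ (lam / 2) (η₀ / 2)) ≤ τ ∧ pcOdd B κ κ κ (2 * (lam / 2)) (η₀ / 2) τ ≤ B.hmin / 2 ∧
      κ * pcAE B κ κ ≤ B.hmin / 2 ∧ pcEven B κ κ κ (lam / 2) (η₀ / 2) τ ≤ B.hmin / 2 ∧ pcDiag B κ κ κ (η₀ / 2) (η₁ / 2) ≤ 2 * B.hmin := by
  have hs := B.smax_pos; have hDt := B.Dtmin_pos; have hCg := B.Cg_pos; have hh := B.hmin_pos; have hA2 := B.A2_pos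
  obtain ⟨hCVb0, hSEbar0, hU1b0, hU2b0, hAEbar0, he4s, hSodd, hSeven, hSdiag⟩ := pcbar_pos B
  -- unpack `κ ≤ κ*`
  have hκ1 : κ ≤ 1 := hκ.trans (min_le_left _ _)
  have hκD : κ ≤ B.Dtmin / 2 := hκ.trans ((min_le_right _ _).trans (min_le_left _ _))
  have hκc : κ ≤ τ / (4 * B.Cg * pcE4slope B) :=
    hκ.trans ((min_le_right _ _).trans ((min_le_right _ _).trans (min_le_left _ _)))
  have hκo : κ ≤ B.hmin / (4 * pcOddSlope B) :=
    hκ.trans ((min_le_right _ _).trans ((min_le_right _ _).trans ((min_le_right _ _).trans (min_le_left _ _))))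
  have hκa : κ ≤ B.hmin / (2 * pcAEbar B) :=
    hκ.trans ((min_le_right _ _).trans ((min_le_right _ _).trans ((min_le_right _ _).trans ((min_le_right _ _).trans (min_le_left _ _)))))
  have hκe : κ ≤ B.hmin / (4 * pcEvenSlope B) :=
    hκ.trans ((min_le_right _ _).trans ((min_le_right _ _).trans ((min_le_right _ _).trans ((min_le_right _ _).trans
      ((min_le_right _ _).trans (min_le_left _ _))))))
  have hκd : κ ≤ B.hmin / pcDiagSlope B :=
    hκ.trans ((min_le_right _ _).trans ((min_le_right _ _).trans ((min_le_right _ _).trans ((min_le_right _ _).trans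
      ((min_le_right _ _).trans (min_le_right _ _))))))
  have kc : κ * (4 * B.Cg * pcE4slope B) ≤ τ := by rwa [le_div_iff₀ (by positivity)] at hκc
  have ko : κ * (4 * pcOddSlope B) ≤ B.hmin := by rwa [le_div_iff₀ (by positivity)] at hκo
  have ka : κ * (2 * pcAEbar B) ≤ B.hmin := by rwa [le_div_iff₀ (by positivity)] at hκa
  have ke : κ * (4 * pcEvenSlope B) ≤ B.hmin := by rwa [le_div_iff₀ (by positivity)] at hκe
  have kd : κ * pcDiagSlope B ≤ B.hmin := by rwa [le_div_iff₀ hSdiag] at hκd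
  -- `A'` dominates `2Ā_E` and `4S̄² + 2Ā`
  have hA' : 4 * pcSEbar B ^ 2 + 2 * pcAEbar B ≤ pcAprime B := le_max_right _ _
  have hA'0 : 0 ≤ pcAprime B := le_trans (by positivity) hA'
  have ediv : η₀ / 2 / B.Dtmin = η₀ / B.Dtmin / 2 := by ring
  -- nonnegative monomials
  have m1 : 0 ≤ η₀ / B.Dtmin := by positivity
  have m4 : 0 ≤ B.smax * (B.Cg * lam) := by positivity
  have m5 : 0 ≤ B.smax * (B.Cg * (B.smax * (η₀ / B.Dtmin))) := by positivity
  have m7 : 0 ≤ B.smax * (B.Cg * η₁) := by positivity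
  have hA'' : 2 * pcAEbar B ≤ pcAprime B := by
    have : 0 ≤ pcSEbar B ^ 2 := sq_nonneg _
    linarith only [hA', this]
  refine ⟨?_, ?_, ?_, ?_, ?_⟩
  · -- covering
    have h := pcE4_le_affine B hκ0 hκ1 hκD (lam / 2) (η₀ / 2)
    rw [ediv] at h
    have h2 : 2 * (B.Cg * pcE4 B κ κ (lam / 2) (η₀ / 2)) ≤ 2 * (B.Cg * (lam / 2 / 2 + 2 * B.smax * (η₀ / B.Dtmin / 2) + κ * pcE4slope B)) :=
      mul_le_mul_of_nonneg_left (mul_le_mul_of_nonneg_left h hCg.le) (by norm_num)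
    linarith only [h2, c1, kc]
  · -- Cooper range
    have h := pcOdd_le_affine B hκ0 hκ1 hκD (L := 2 * (lam / 2)) (η₀ := η₀ / 2) (τ := τ) (by linarith) (by linarith) hτ.le
    rw [ediv] at h
    have hY : η₀ / B.Dtmin / 2 + B.smax * (B.Cg * (2 * (lam / 2) / 2 + 2 * B.smax * (η₀ / B.Dtmin / 2)) + τ) ≤
        η₀ / B.Dtmin + B.smax * (B.Cg * (lam + 2 * B.smax * (η₀ / B.Dtmin)) + τ) := by linarith only [m1, m4, m5]
    have hYpos : 0 ≤ η₀ / B.Dtmin / 2 + B.smax * (B.Cg * (2 * (lam / 2) / 2 + 2 * B.smax * (η₀ / B.Dtmin / 2)) + τ) := by positivity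
    have h1 : 2 * pcAEbar B * (η₀ / B.Dtmin / 2 + B.smax * (B.Cg * (2 * (lam / 2) / 2 + 2 * B.smax * (η₀ / B.Dtmin / 2)) + τ)) ≤
        pcAprime B * (η₀ / B.Dtmin + B.smax * (B.Cg * (lam + 2 * B.smax * (η₀ / B.Dtmin)) + τ)) :=
      mul_le_mul hA'' hY hYpos hA'0
    linarith only [h, h1, c2, ko]
  · -- `κ A_E`
    obtain ⟨-, hAEb⟩ := pcAE_le_bar B hκ0 hκ1 hκD
    have := mul_le_mul_of_nonneg_left hAEb hκ0
    linarith only [this, ka]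
  · -- fold
    have h := pcEven_le_affine B hκ0 hκ1 hκD (lam := lam / 2) (η₀ := η₀ / 2) (τ := τ) (by linarith) (by linarith) hτ.le
    rw [ediv] at h
    have hτA : 5 / 4 * pcAEbar B * τ ≤ pcAprime B * τ := mul_le_mul_of_nonneg_right (by linarith only [hA'', hAEbar0]) hτ.le
    have hmon := mul_le_mul_of_nonneg_left (mul_le_mul_of_nonneg_left hτA hCg.le) hs.le
    have hY : η₀ / B.Dtmin / 2 + B.smax * (B.Cg * (lam / 2 + 5 / 4 * pcAEbar B * τ + 2 * B.smax * (η₀ / B.Dtmin / 2)) + τ / 2) ≤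
        η₀ / B.Dtmin + B.smax * (B.Cg * (lam + pcAprime B * τ + 2 * B.smax * (η₀ / B.Dtmin)) + τ / 2) := by
      linarith only [hmon, m1, m4, m5]
    have hYpos : 0 ≤ η₀ / B.Dtmin / 2 + B.smax * (B.Cg * (lam / 2 + 5 / 4 * pcAEbar B * τ + 2 * B.smax * (η₀ / B.Dtmin / 2)) + τ / 2) := by
      positivity
    have h1 : 2 * pcAEbar B * (η₀ / B.Dtmin / 2 + B.smax * (B.Cg * (lam / 2 + 5 / 4 * pcAEbar B * τ + 2 * B.smax * (η₀ / B.Dtmin / 2)) + τ / 2)) ≤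
        pcAprime B * (η₀ / B.Dtmin + B.smax * (B.Cg * (lam + pcAprime B * τ + 2 * B.smax * (η₀ / B.Dtmin)) + τ / 2)) :=
      mul_le_mul hA'' hY hYpos hA'0
    linarith only [h, h1, c3, ke]
  · -- diagonal
    have h := pcDiag_le_affine B hκ0 hκ1 hκD (η₀ := η₀ / 2) (η₁ := η₁ / 2) (by linarith) (by linarith)
    rw [ediv] at h
    have hW : η₀ / B.Dtmin / 2 + B.smax * (B.Cg * (η₁ / 2 / 4 + 2 * B.smax * (η₀ / B.Dtmin / 2))) ≤
        (η₀ / B.Dtmin + B.smax * (B.Cg * (η₁ / 4 + 2 * B.smax * (η₀ / B.Dtmin)))) / 2 := by linarith only [m1, m5, m7]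
    have hWpos : 0 ≤ η₀ / B.Dtmin / 2 + B.smax * (B.Cg * (η₁ / 2 / 4 + 2 * B.smax * (η₀ / B.Dtmin / 2))) := by positivity
    have hs2 : 0 ≤ B.smax ^ 2 := sq_nonneg _
    have hco : 16 * pcSEbar B ^ 2 + 8 * pcAEbar B ≤ (16 * B.smax ^ 2 + 8 * pcAprime B) / 2 := by linarith only [hA', hs2]
    have h1 : (16 * pcSEbar B ^ 2 + 8 * pcAEbar B) * (η₀ / B.Dtmin / 2 + B.smax * (B.Cg * (η₁ / 2 / 4 + 2 * B.smax * (η₀ / B.Dtmin / 2)))) ≤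
        (16 * B.smax ^ 2 + 8 * pcAprime B) / 2 * ((η₀ / B.Dtmin + B.smax * (B.Cg * (η₁ / 4 + 2 * B.smax * (η₀ / B.Dtmin)))) / 2) :=
      mul_le_mul hco hW hWpos (by positivity)
    linarith only [h, h1, c4, kd, hh]

/-- `0 < κ*(τ)` for `τ > 0`. [folklore] -/
theorem pcKappa_pos {a b : ℝ} (B : BandBounds a b) {τ : ℝ} (hτ : 0 < τ) : 0 < pcKappa B τ := by
  have hDt := B.Dtmin_pos; have hh := B.hmin_pos; have hCg := B.Cg_pos
  obtain ⟨-, -, -, -, hAEbar0, he4s, hSodd, hSeven, hSdiag⟩ := pcbar_pos B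
  unfold pcKappa
  exact lt_min one_pos (lt_min (by positivity) (lt_min (by positivity) (lt_min (by positivity) (lt_min (by positivity)
    (lt_min (by positivity) (by positivity))))))

/-- **The small constants with an EXPLICIT perturbation size**: for every `BandBounds` bundle and margin `m₀ > 0` there are free constants
`τ < π`, `λ, η₀ ≤ m₀, η₁ > 0` (the lineage's, for the bundle with `A₂ ↦ pcAprime B`, halved) such that EVERY `0 ≤ κ ≤ pcKappa B τ`
satisfies the five conditions of `count_pairs_perturbed_exists` with `κ₀ = κ₁ = κ₂ = κ`. [folklore] -/
theorem exists_small_constants_perturbed_explicit {a b : ℝ} (B : BandBounds a b) {m₀ : ℝ} (hm₀ : 0 < m₀) :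
    ∃ τ lam η₀ η₁ : ℝ, 0 < τ ∧ τ < π ∧ 0 < lam ∧ 0 < η₀ ∧ η₀ ≤ m₀ ∧ 0 < η₁ ∧ 0 < pcKappa B τ ∧
      ∀ κ : ℝ, 0 ≤ κ → κ ≤ pcKappa B τ →
        2 * (B.Cg * pcE4 B κ κ lam η₀) ≤ τ ∧ pcOdd B κ κ κ (2 * lam) η₀ τ ≤ B.hmin / 2 ∧ κ * pcAE B κ κ ≤ B.hmin / 2 ∧
        pcEven B κ κ κ lam η₀ τ ≤ B.hmin / 2 ∧ pcDiag B κ κ κ η₀ η₁ ≤ 2 * B.hmin := by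
  have hA2 := B.A2_pos
  let B' : BandBounds a b :=
    { B with
      A2 := pcAprime B
      A2_pos := lt_max_of_lt_left B.A2_pos
      abs_AX_le := fun μ hμ θ => (B.abs_AX_le μ hμ θ).trans (le_max_left _ _)
      abs_AY_le := fun μ hμ θ => (B.abs_AY_le μ hμ θ).trans (le_max_left _ _) }
  obtain ⟨τ, lam, η₀, η₁, hτ, hτπ, hlam, hη₀, hη₀m, hη₁, c1, c2, c3, c4⟩ := exists_small_constants_offset B' hm₀
  refine ⟨τ, lam / 2, η₀ / 2, η₁ / 2, hτ, hτπ, by linarith, by linarith, by linarith, by linarith, pcKappa_pos B hτ, fun κ hκ0 hκ => ?_⟩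
  exact perturbed_conditions_of_free B hτ hlam hη₀ hη₁ c1 c2 c3 c4 hκ0 hκ

end Summit.HubbardSuperconductivity.HubbardSuperconductivity.Theorems.PerturbedFermiCurve

end
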